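import Mathlib.Combinatorics.SimpleGraph.Connectivity.Connected
import Mathlib.Analysis.SpecialFunctions.Trigonometric.Basic
import Mathlib.Analysis.SpecialFunctions.Exp
import Mathlib.Computability.Encoding
import Literature.Computability.Complexity.BoolEncodings
import Literature.Computability.Complexity.Promise
import HarnessLib

/-!
# Braid words, the Kauffman bracket of a plat closure, and the Aharonov–Jones–Landau problem

Trunk T-CPLX-QUANT (Literature/Computability/QuantumComplexity); definition request
`defn-jonesApproxProblem` (route QuantumAdvantage/PromiseLift, crux #3).

## Mathematical content

* A **braid word** on `n` strands is a list of signed Artin generators `σᵢ^{±1}`, `i < n - 1`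
  (`BraidWord n = List (Fin (n - 1) × Bool)`, `true` = positive).
* The **plat closure** `b^{pl}` of a braid `b` with an even number `n` of strands connects the
  strand ends `(2l, 2l+1)` pairwise at the top and at the bottom (AJL Def. 2.7).
* The **Kauffman bracket** `⟨L⟩(A) = Σ_σ A^{σ₊ - σ₋} d^{|σ| - 1}`, `d = -A² - A⁻²`, sum over states
  `σ` choosing at each crossing one of the two smoothings, `|σ|` = number of closed loops
  (AJL Def. 2.8; Kauffman 1987). For a braid diagram every crossing `σᵢ^{±1}` has the "identity"
  smoothing (two vertical strands) and the "capcup" smoothing `Eᵢ`; following AJL Def. 2.5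
  (`ρ_A(σᵢ) = A Eᵢ + A⁻¹ I`) the capcup smoothing of a positive crossing carries `A` and the identity
  smoothing `A⁻¹`, and conversely for `σᵢ⁻¹`. We COMPUTE `|σ|` combinatorially: the smoothed plat
  diagram is a graph on the points `(level j, position p)`, `j ≤ m`, `p < n`, whose edges are the
  vertical strand segments, the capcups chosen by `σ`, and the plat caps; every point has degree
  `2`, so `|σ|` is its number of connected components (Mathlib `SimpleGraph.ConnectedComponent`;
  parallel arcs collapse to one edge without changing connectivity).
* The **Jones polynomial** `V_L(t) = (-A)^{3 w(L)} ⟨L⟩` at `t = A⁻⁴` (AJL Def. 2.10); at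
  `A = i e^{-iπ/(2k)}` one has `t = e^{2πi/k}`, `d = 2 cos(π/k)` (AJL §3, proof of Thm. 1.1) and
  `|V_L(t)| = |⟨L⟩(A)|` since `|A| = 1`, so the modulus needs no orientation/writhe:
  `jonesPlatModulus k b = |V_{b^{pl}}(e^{2πi/k})|`.
* The **AJL promise problem at the fifth root of unity** (`jonesApproxProblem`), in the threshold
  form requested by the route: instances `⟨n, b, θ_num, θ_den, prec⟩` (`n` even `≥ 2`, `b` a braid
  word on `n` strands given with `ℕ` generator indices, `θ = θ_num/θ_den`, `prec ≥ 1` IN UNARY so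
  the promise gap `1/prec` is inverse polynomial in the input length);
  YES: `|V_{b^{pl}}(e^{2πi/5})| / d^{n/2-1} ≥ θ + 1/prec`; NO: `≤ θ` (`d = 2cos(π/5)`, the golden
  ratio). Additive approximation of `V_{b^{pl}}(e^{2πi/k})` to within `ε d^{n/2-1}`-type windows is
  BQP-complete (AJL Thms. 1.2–1.3 for constant `k`; Freedman–Larsen–Wang 2002; Aharonov–Arad 2011,
  Thm. 1.1, for all polynomial `k`); the threshold form is the standard promise-decision version of
  that additive approximation task.

## Sources

* D. Aharonov, V. Jones, Z. Landau, *A polynomial quantum algorithm for approximating the Jones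
  polynomial*, Algorithmica 55 (2009) 395–421 (arXiv:quant-ph/0511096): Def. 2.5 (`ρ_A`), Def. 2.7
  (plat closure), Def. 2.8 (bracket state sum), Def. 2.10 (Jones polynomial), Thms. 1.1–1.3.
* D. Aharonov, I. Arad, *The BQP-hardness of approximating the Jones polynomial*, New J. Phys. 13
  (2011) 035019, §1 (problem statement, Thm. 1.1).
* M. Freedman, M. Larsen, Z. Wang, *A modular functor which is universal for quantum
  computation*, CMP 227 (2002) 605.
* L. H. Kauffman, *State models and the Jones polynomial*, Topology 26 (1987) 395.

## Design choices

* State-sum (Kauffman bracket) route, not the path-model representation: no Temperley–Lieb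
  algebra is needed, only loop counting, which is a connected-component count.
* Braid words as data are `List (Fin (n-1) × Bool)` (requester's format); the state sum is written
  for `Fin m`-indexed words (`w = b.get`). Raw instances carry `ℕ` indices and are validated
  (`RawJonesInstance.IsValid`); invalid strings are neither YES nor NO.
* Junk: for odd `n` the last strand is left open by the "plat caps" (the diagram is then a tangle;
  the count still type-checks); `d ^ (n/2 - 1)` uses `ℕ` division/subtraction, exact for even
  `n ≥ 2`; `⟨L⟩` uses `d ^ (|σ| - 1)` with `|σ| ≥ 1` whenever `n ≥ 1`.
* Mathlib has braid groups only abstractly (`PresentedGroup` could host Artin's presentation) and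
  no knot polynomials (searched `braid`, `Jones`, `Kauffman`, `Temperley`): genuine new topic.
-/

noncomputable section

open Computability Complex

namespace Literature.Computability.QuantumComplexity

/-! ### Braid words and smoothing states -/

/-- A braid word on `n` strands: a list of signed Artin generators `(i, ε)`, `σᵢ^{ε}` with
`i < n - 1` acting on strands `i, i+1` and `ε = true` for `σᵢ`, `false` for `σᵢ⁻¹`.
[Aharonov–Jones–Landau 2009, §2.1 (Artin generators of `Bₙ`)] [cite: AharonovJonesLandau2009, §2.1] -/
abbrev BraidWord (n : ℕ) : Type := List (Fin (n - 1) × Bool)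

/-- The points of the sliced plat diagram of an `m`-crossing braid word on `n` strands: level
`j ∈ {0, …, m}` (below crossing `j+1`, above crossing `j`) and strand position `p < n`. [Aharonov–Jones–Landau 2009, §2 (braid diagrams)] [folklore] -/
abbrev DiagramPoint (m n : ℕ) : Type := Fin (m + 1) × Fin n

/-- The arcs of the plat diagram of the word `w` smoothed according to the state `s`
(`s j = true`: crossing `j` replaced by the capcup `Eᵢ`; `false`: by two vertical strands), as a
relation on diagram points: vertical strand segments across level `j → j+1` (absent at the two
positions of a capcup-smoothed crossing), the two horizontal arcs of each capcup, and the plat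
caps joining positions `(2l, 2l+1)` at the bottom level `0` and the top level `m`.
[Aharonov–Jones–Landau 2009, Def. 2.7 (plat closure), Def. 2.8 (states and smoothings)] [cite: AharonovJonesLandau2009, Def. 2.8] -/
def smoothingRel {m n : ℕ} (w : Fin m → Fin (n - 1) × Bool) (s : Fin m → Bool) :
    DiagramPoint m n → DiagramPoint m n → Prop := fun v v' =>
  -- vertical strand segments through the level of crossing `j`
  (∃ j : Fin m, v.1 = j.castSucc ∧ v'.1 = j.succ ∧ v.2 = v'.2 ∧
      ¬ (s j = true ∧ ((v.2 : ℕ) = (w j).1 ∨ (v.2 : ℕ) = (w j).1 + 1))) ∨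
  -- capcup smoothing of crossing `j`: horizontal arcs below and above it
  (∃ j : Fin m, s j = true ∧ (v.2 : ℕ) = (w j).1 ∧ (v'.2 : ℕ) = (w j).1 + 1 ∧
      ((v.1 = j.castSucc ∧ v'.1 = j.castSucc) ∨ (v.1 = j.succ ∧ v'.1 = j.succ))) ∨
  -- plat closure caps at the bottom and at the top
  (((v.1 = 0 ∧ v'.1 = 0) ∨ (v.1 = Fin.last m ∧ v'.1 = Fin.last m)) ∧
      Even (v.2 : ℕ) ∧ (v'.2 : ℕ) = (v.2 : ℕ) + 1)

/-- The smoothed plat diagram of state `s` as a simple graph on diagram points (Mathlib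
`SimpleGraph.fromRel`, symmetrised; parallel arcs become one edge, which does not change the
components). [Aharonov–Jones–Landau 2009, Def. 2.8] [folklore] -/
def smoothingGraph {m n : ℕ} (w : Fin m → Fin (n - 1) × Bool) (s : Fin m → Bool) :
    SimpleGraph (DiagramPoint m n) :=
  SimpleGraph.fromRel (smoothingRel w s)

/-- The number `|σ|` of closed loops of the state `s`: the number of connected components of the
smoothed plat diagram (every point has degree two, so components are exactly the loops).
[Aharonov–Jones–Landau 2009, Def. 2.8 (`|σ|`)] [cite: AharonovJonesLandau2009, Def. 2.8] -/
def loopCount {m n : ℕ} (w : Fin m → Fin (n - 1) × Bool) (s : Fin m → Bool) : ℕ :=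
  Nat.card (smoothingGraph w s).ConnectedComponent

/-! ### The Kauffman bracket and the Jones modulus of a plat closure -/

/-- The weight of a smoothed crossing in the bracket state sum, AJL convention
`ρ_A(σᵢ) = A Eᵢ + A⁻¹ I`: a positive crossing contributes `A` when capcup-smoothed and `A⁻¹` when
identity-smoothed; a negative crossing the reverse. [Aharonov–Jones–Landau 2009, Def. 2.5 and
Def. 2.8 (`A^{σ₊ - σ₋}`)] [cite: AharonovJonesLandau2009, Def. 2.5] -/
def crossingWeight (A : ℂ) (positive smooth : Bool) : ℂ :=
  if positive = smooth then A else A⁻¹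

/-- The loop value `d = -A² - A⁻²`. [Aharonov–Jones–Landau 2009, Thm. 1.1, Claim 2.1] [cite: AharonovJonesLandau2009, Claim 2.1] -/
def loopValue (A : ℂ) : ℂ :=
  -A ^ 2 - A⁻¹ ^ 2

/-- **The Kauffman bracket of the plat closure** of the `m`-crossing braid word `w` on `n` strands:
`⟨w^{pl}⟩(A) = Σ_{σ : Fin m → Bool} (∏_j weight_j(σ)) · d^{|σ| - 1}`.
[Aharonov–Jones–Landau 2009, Def. 2.8 (bracket state sum); Kauffman 1987] [cite: AharonovJonesLandau2009, Def. 2.8] -/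
def kauffmanBracketPlat {m n : ℕ} (A : ℂ) (w : Fin m → Fin (n - 1) × Bool) : ℂ :=
  ∑ s : Fin m → Bool, (∏ j, crossingWeight A (w j).2 (s j)) * loopValue A ^ (loopCount w s - 1)

/-- The AJL evaluation point `A_k = i e^{-iπ/(2k)}`, for which `A_k⁻⁴ = e^{2πi/k}` and
`d = -A_k² - A_k⁻² = 2 cos(π/k)`. [Aharonov–Jones–Landau 2009, §3 (proof of Thm. 1.1:
"`d = -A² - A⁻²` for `A = i e^{-πi/2k}`")] [cite: AharonovJonesLandau2009, §3] -/
def ajlPoint (k : ℕ) : ℂ :=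
  I * exp (-(Real.pi / (2 * k) : ℝ) * I)

/-- The loop value at level `k`, `d = 2 cos(π/k)` (as a real number).
[Aharonov–Jones–Landau 2009, Thm. 1.1] [cite: AharonovJonesLandau2009, Thm. 1.1] -/
def ajlLoopValue (k : ℕ) : ℝ :=
  2 * Real.cos (Real.pi / k)

/-- **`|V_{b^{pl}}(e^{2πi/k})|`**, the modulus of the Jones polynomial of the plat closure of the
braid word `b` at the `k`-th root of unity, computed as `|⟨b^{pl}⟩(A_k)|`
(`V_L(A⁻⁴) = (-A)^{3w(L)} ⟨L⟩` and `|A_k| = 1`, so the writhe/orientation drops out of the modulus).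
[Aharonov–Jones–Landau 2009, Def. 2.10, Thm. 1.2] [cite: AharonovJonesLandau2009, Def. 2.10] -/
def jonesPlatModulus (k : ℕ) {n : ℕ} (b : BraidWord n) : ℝ :=
  ‖kauffmanBracketPlat (ajlPoint k) b.get‖

/-- The normalised AJL quantity `|V_{b^{pl}}(e^{2πi/k})| / d^{n/2 - 1}` (`n` even; `ℕ` division and
subtraction). [Aharonov–Jones–Landau 2009, Thm. 1.2 (approximation window `∝ d^{n/2-1}`·…);
Aharonov–Arad 2011, §1] [cite: AharonovJonesLandau2009, Thm. 1.2] -/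
def ajlRatio (k n : ℕ) (b : BraidWord n) : ℝ :=
  jonesPlatModulus k b / ajlLoopValue k ^ (n / 2 - 1)

/-! ### The promise problem at the fifth root of unity -/

/-- A raw instance of the AJL problem: number of strands `n`, a word with `ℕ` generator indices and
signs, threshold numerator/denominator `θ_num, θ_den`, and precision `prec`.
[Aharonov–Jones–Landau 2009, Thms. 1.2–1.3] [folklore] -/
abbrev RawJonesInstance : Type := ℕ × List (ℕ × Bool) × ℕ × ℕ × ℕ

namespace RawJonesInstance

/-- Validity of a raw instance: `n` even and `≥ 2`, every generator index `< n - 1`, `θ_den ≥ 1`,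
`prec ≥ 1`. [Aharonov–Jones–Landau 2009, Def. 2.7 (plat closure needs an even number of strands)] [folklore] -/
def IsValid (x : RawJonesInstance) : Prop :=
  Even x.1 ∧ 2 ≤ x.1 ∧ (∀ g ∈ x.2.1, g.1 < x.1 - 1) ∧ 1 ≤ x.2.2.2.1 ∧ 1 ≤ x.2.2.2.2

/-- The braid word of a raw instance: generators with index `< n - 1` are kept (all of them on
valid instances), out-of-range ones (invalid instances only) are dropped. [folklore] -/
def toBraidWord (x : RawJonesInstance) : BraidWord x.1 :=
  x.2.1.filterMap fun g => if h : g.1 < x.1 - 1 then some (⟨g.1, h⟩, g.2) else none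

/-- The threshold `θ = θ_num / θ_den`. [folklore] -/
def threshold (x : RawJonesInstance) : ℝ :=
  (x.2.2.1 : ℝ) / (x.2.2.2.1 : ℝ)

/-- The precision parameter `prec` (encoded in unary). [folklore] -/
def prec (x : RawJonesInstance) : ℕ :=
  x.2.2.2.2

/-- YES-instances: valid and `|V_{b^{pl}}(e^{2πi/5})| / d^{n/2-1} ≥ θ + 1/prec`.
[Aharonov–Jones–Landau 2009, Thms. 1.2–1.3; Aharonov–Arad 2011, §1] [cite: AharonovJonesLandau2009, Thm. 1.3] -/
def yesSet : Set RawJonesInstance :=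
  {x | x.IsValid ∧ x.threshold + 1 / (x.prec : ℝ) ≤ ajlRatio 5 x.1 x.toBraidWord}

/-- NO-instances: valid and `|V_{b^{pl}}(e^{2πi/5})| / d^{n/2-1} ≤ θ`.
[Aharonov–Jones–Landau 2009, Thms. 1.2–1.3; Aharonov–Arad 2011, §1] [cite: AharonovJonesLandau2009, Thm. 1.3] -/
def noSet : Set RawJonesInstance :=
  {x | x.IsValid ∧ ajlRatio 5 x.1 x.toBraidWord ≤ x.threshold}

/-- The Boolean encoding of raw instances: binary `n`, the word as a list of (binary index, sign)
pairs, binary `θ_num`, `θ_den`, and `prec` in UNARY (Mathlib `unaryEncodingNat`), via the tree's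
`pairBool`/`listBool` combinators. [Goldreich 2006, §1.1 (encodings); Arora–Barak 2009, §0.1] [folklore] -/
def encoding : Encoding RawJonesInstance Bool :=
  encodingNatBool.pairBool <|
    (encodingNatBool.pairBool encodingBoolBool).listBool.pairBool <|
      encodingNatBool.pairBool <| encodingNatBool.pairBool unaryEncodingNat

end RawJonesInstance

/-- **The Aharonov–Jones–Landau problem at the fifth root of unity** as a promise problem over
`{0,1}*`: YES = encodings of valid `⟨n, b, θ_num, θ_den, prec⟩` with
`|V_{b^{pl}}(e^{2πi/5})| / d^{n/2-1} ≥ θ_num/θ_den + 1/prec`, NO = those with `≤ θ_num/θ_den`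
(`d = 2 cos(π/5)`; `prec` in unary, so the gap is inverse-polynomial in the input length). Additive
approximation of the plat-closure Jones polynomial at `e^{2πi/k}` is BQP-complete
(AJL Thms. 1.2–1.3, Freedman–Larsen–Wang; Aharonov–Arad Thm. 1.1); this is its threshold
(promise-decision) form. [Aharonov–Jones–Landau 2009, Thms. 1.2–1.3; Aharonov–Arad 2011, §1;
Freedman–Larsen–Wang 2002] [cite: AharonovJonesLandau2009, Thm. 1.3] -/
def jonesApproxProblem : Literature.Computability.Complexity.PromiseProblem :=
  Literature.Computability.Complexity.PromiseProblem.ofEncoding RawJonesInstance.encoding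
    RawJonesInstance.yesSet RawJonesInstance.noSet

/-! ### API -/

/-- The YES- and NO-sets are disjoint (the gap `1/prec > 0`), hence so is the promise problem's
underlying pair of instance sets. [Aharonov–Arad 2011, §1] [folklore] -/
theorem disjoint_yesSet_noSet : Disjoint RawJonesInstance.yesSet RawJonesInstance.noSet := by
  rw [Set.disjoint_left]
  rintro x ⟨hv, hy⟩ ⟨-, hn⟩
  have hp : (0 : ℝ) < 1 / (x.prec : ℝ) := by
    have : (1 : ℝ) ≤ x.prec := by exact_mod_cast hv.2.2.2.2
    positivity
  linarith

/-- The problem's yes/no languages, unfolded. [folklore] -/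
theorem jonesApproxProblem_yes :
    jonesApproxProblem.yes = RawJonesInstance.encoding.encode '' RawJonesInstance.yesSet := rfl

/-- Weights of a positive crossing: capcup `A`, identity `A⁻¹` (AJL Def. 2.5). [folklore] -/
@[simp] theorem crossingWeight_true (A : ℂ) (sm : Bool) :
    crossingWeight A true sm = if sm then A else A⁻¹ := by
  cases sm <;> simp [crossingWeight]

/-- Weights of a negative crossing: capcup `A⁻¹`, identity `A`. [folklore] -/
@[simp] theorem crossingWeight_false (A : ℂ) (sm : Bool) :
    crossingWeight A false sm = if sm then A⁻¹ else A := by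
  cases sm <;> simp [crossingWeight]

/-- With no crossings the bracket is `d^{|∅| - 1}` (a single, empty state). [Kauffman 1987] [folklore] -/
theorem kauffmanBracketPlat_nil {n : ℕ} (A : ℂ) (w : Fin 0 → Fin (n - 1) × Bool) :
    kauffmanBracketPlat A w = loopValue A ^ (loopCount w (fun i => i.elim0) - 1) := by
  simp only [kauffmanBracketPlat, Finset.univ_unique, Finset.sum_singleton, Finset.univ_eq_empty,
    Finset.prod_empty, one_mul]
  congr

end Literature.Computability.QuantumComplexity
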